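import Mathlib.RingTheory.KrullDimension.Polynomial
import Mathlib.RingTheory.KrullDimension.Field
import Literature.NumberTheory.Transcendental.ZilberField
import Literature.NumberTheory.Transcendental.ExpDominantSolvability
import HarnessLib

/-!
# Zilber's Exponential-Algebraic Closedness for `ℂ_exp`: the case ladder

Zilber's *Exponential-Algebraic Closedness* conjecture (EAC, also EC, "Zilber's Nullstellensatz";
Zilber, APAL 132 (2005) §1 axiom (EC) and §5) for the complex exponential field is the statement
`Literature.NumberTheory.Transcendental.IsExpAlgClosed ℂ` of `ZilberField.lean`: every irreducible,
rotund, additively and multiplicatively free subvariety `V = W ∩ Gⁿ` of `Gⁿ = ℂⁿ × (ℂˣ)ⁿ` of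
dimension `n` meets the graph of `exp`. This file does NOT restate that definition, nor the
vocabulary `IsRotund / IsAddFree / IsMulFree / torusLocus / expGraph / zariskiDim / projAdd /
HasDominantAddProjection` (`ExpVarieties.lean`, `ExpDominantSolvability.lean`); it records, over
that vocabulary,

1. the **case ladder**: `ECCell n d` = EAC restricted to varieties whose additive projection
   `π(V) ⊆ ℂⁿ` has Zariski closure of dimension `d` (`addProjDim`), with the proved
   decomposition `IsExpAlgClosed ℂ ↔ ∀ n d, ECCell n d` (`isExpAlgClosed_complex_iff_forall_ecCell`);
2. one NAMED FACT per case proved in the refereed literature, hypotheses as printed: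
   `marker2006_cor_2_4` (`n = 1`), `aslanyanKirbyMantova2023_thm_1_5` (dominant additive projection,
   = Brownawell–Masser 2017 Prop. 2 without the dimension hypothesis — the `dim V = n` form is the
   tree THEOREM `BrownawellMasser2017_dominantProjection_holds`), `mantovaMasser2024_thm_1_1`
   (`dim π(V) = 1`), `gallinaro2023_thm_8_8` (`V = L × W`, `L` linear), and the printed corollary
   `aslanyanGallinaro2024_ec_le_two` (all of `ℂ² × (ℂˣ)²`);
3. the reduction `ecCell_of_nonsplit` of a cell to its non-split part (`IsLinearSplit`,
   `ECCellNonsplit`) modulo Gallinaro's theorem, and the bookkeeping assembly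
   `isExpAlgClosed_complex_of_ladder` (known cells + the open regime `n ≥ 3`, `2 ≤ d ≤ n − 1` ⊢ EAC).

The literature's own FIRST OPEN CASE — Mantova–Masser, PLMS 129 (2024), §1 "Further remarks": "It
would also be interesting to extend the investigations to `π(V)` of other dimensions. The simplest
case of dimension 2 in `ℂ³ × ℂ*³` leads to systems of equations such as `e^z + e^{z²−w²} = z`,
`e^w + e^{z²−w²} = −w`" — is the cell `ECCell 3 2` of this file. Being unproved it is NOT a named
fact here (unproven statements are obligations of our theories, never Literature facts): whoever
attacks it summit-side files `@[conjecture] def ECThreeTwo : Prop := ECCell 3 2` (and, for the whole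
open regime `n ≥ 3`, `2 ≤ d ≤ n − 1`, the binder `hopen` of `isExpAlgClosed_complex_of_ladder`)
under `Summits/Schanuel/Schanuel/Theorems/`. Nothing open is asserted in this file.

Honest framing (Aslanyan–Gallinaro 2024, §3.5): "There are no known implications between Schanuel's
conjecture and Exponential Closedness (and it is not expected that there are any)". Placement of
EAC relative to Schanuel's conjecture and to quasiminimality of `ℂ_exp` is in `Placement.lean`.

Design. As in `IsExpAlgClosed`, a subvariety `V` of `Gⁿ` is presented by an irreducible Zariski
closed `W ⊆ ℂ^{2n}` meeting `torusLocus`, `V = W ∩ torusLocus ℂ n`; "the Zariski closure of `π(V)`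
has dimension `d`" is `zariskiDim ℂ (projAdd '' V) = d` (`zariskiDim` is the Krull dimension of the
coordinate ring of the closure). Mantova–Masser's `dim V ≥ n` is `(n : WithBot ℕ∞) ≤ zariskiDim ℂ W`.
Gallinaro's varieties `L × W` (`L ≤ ℂⁿ` a linear subspace, `W ⊆ (ℂˣ)ⁿ` an irreducible algebraic
subvariety, presented by its closure `Z ⊆ ℂⁿ`) are `splitProd ↑L Z`.

## References
* B. Zilber, *Pseudo-exponentiation on algebraically closed fields of characteristic zero*, APAL
  132 (2005) 67–95, §1, §5.
* D. Marker, *A remark on Zilber's pseudoexponentiation*, J. Symb. Logic 71 (2006) 791–798, Cor. 2.4,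
  Thm. 1.6.
* W. D. Brownawell, D. W. Masser, *Zero estimates with moving targets*, JLMS 95 (2017), Prop. 2.
* V. Aslanyan, J. Kirby, V. Mantova, *A geometric approach to some systems of exponential
  equations*, IMRN 2023 (arXiv:2105.12679), Thm. 1.5, §6.
* V. Mantova, D. Masser, *Polynomial-exponential equations — some new cases of solvability*,
  PLMS 129 (2024) e12627 (arXiv:2303.05592), Thm. 1.1, Thm. 1.2, §1.
* F. Gallinaro, *Exponential sums equations and tropical geometry*, Selecta Math. 29 (2023)
  (arXiv:2203.13767), Thm. 8.8, Def. 3.1, Conj. 3.2.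
* V. Aslanyan, F. Gallinaro, *Exponential sums equations and the Exponential Closedness conjecture*,
  arXiv:2409.12860 (2024), Conj. 3.4, Thms. 3.6–3.9, §3.4–3.5.
* V. Aslanyan, *The existential closedness and Zilber–Pink conjectures*, Model Theory 3 (2024), §2.
-/

noncomputable section

open MvPolynomial

namespace Literature.ModelTheory.Zilber

open Literature.NumberTheory.Transcendental

variable {K : Type*} {n : ℕ}

/-! ### Projections and split varieties -/

/-- The projection `Kⁿ × Kⁿ → Kⁿ` to the multiplicative coordinates (`Sum.inr`), companion of
`Literature.NumberTheory.Transcendental.projAdd`. [folklore] -/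
def projMul (z : Fin n ⊕ Fin n → K) : Fin n → K :=
  fun i => z (Sum.inr i)

/-- `projMul` reads the `inr` coordinates. [folklore] -/
@[simp] theorem projMul_apply (z : Fin n ⊕ Fin n → K) (i : Fin n) : projMul z i = z (Sum.inr i) :=
  rfl

/-- The product set `L × Z ⊆ Kⁿ × Kⁿ` of a set of additive and a set of multiplicative coordinates
(Gallinaro 2023 §3: varieties "that split as the product of a linear subspace of `ℂⁿ` and an
algebraic subvariety of `(ℂˣ)ⁿ`"). [cite: Gallinaro2022, §1 and Thm. 8.8] -/
def splitProd (L Z : Set (Fin n → K)) : Set (Fin n ⊕ Fin n → K) :=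
  {z | projAdd z ∈ L ∧ projMul z ∈ Z}

/-- Membership in `splitProd`. [folklore] -/
@[simp] theorem mem_splitProd_iff {L Z : Set (Fin n → K)} {z : Fin n ⊕ Fin n → K} :
    z ∈ splitProd L Z ↔ projAdd z ∈ L ∧ projMul z ∈ Z :=
  Iff.rfl

variable [Field K]

variable (K n) in
/-- `W ⊆ K^{2n}` *splits linearly*: `W = L × Z` with `L ≤ Kⁿ` a linear subspace and `Z ⊆ Kⁿ`
irreducible Zariski closed — the shape of variety treated by Gallinaro 2023, Thm. 8.8 (there
`W ⊆ (ℂˣ)ⁿ` irreducible algebraic; here presented by its closure `Z` in `Kⁿ`). A translate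
`(a + L) × Z` reduces to this shape by the shift `(x, y) ↦ (x - a, e^{-a} y)`, which preserves the
graph of `exp`. [cite: Gallinaro2022, Thm. 8.8] -/
def IsLinearSplit (W : Set (Fin n ⊕ Fin n → K)) : Prop :=
  ∃ (L : Submodule K (Fin n → K)) (Z : Set (Fin n → K)),
    IsIrreducibleClosed K Z ∧ W = splitProd (L : Set (Fin n → K)) Z

variable (K n) in
/-- The dimension of the Zariski closure in `Kⁿ` of the additive projection `π(V)` of
`V = W ∩ (Kⁿ × (Kˣ)ⁿ)` (Mantova–Masser 2024 §1: "the Zariski closure of `π(V)` in `ℂⁿ` has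
dimension …"; `zariskiDim` is the Krull dimension of the coordinate ring of the closure).
[cite: MantovaMasser2023, Thm. 1.1] -/
def addProjDim (W : Set (Fin n ⊕ Fin n → K)) : WithBot ℕ∞ :=
  zariskiDim K (projAdd '' (W ∩ torusLocus K n))

/-- Dominance of the additive projection in the sense of `HasDominantAddProjection` ("no nonzero
polynomial in the additive coordinates vanishes on `V`") says exactly that the vanishing ideal of
`π(V)` is zero, i.e. the Zariski closure of `π(V)` is all of `Kⁿ`. [folklore] -/
theorem hasDominantAddProjection_iff_vanishingIdeal_eq_bot (V : Set (Fin n ⊕ Fin n → K)) :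
    HasDominantAddProjection K V ↔ vanishingIdeal K (projAdd '' V) = ⊥ := by
  constructor
  · intro h
    refine le_bot_iff.mp fun p hp => ?_
    rw [Ideal.mem_bot]
    refine h p fun z hz => ?_
    have := (mem_vanishingIdeal_iff.mp hp) (projAdd z) ⟨z, hz, rfl⟩
    exact this
  · intro h p hp
    have : p ∈ vanishingIdeal K (projAdd '' V) := by
      rw [mem_vanishingIdeal_iff]
      rintro _ ⟨z, hz, rfl⟩
      exact hp z hz
    rw [h, Ideal.mem_bot] at this
    exact this

/-- The Zariski dimension of a nonempty subset of affine `n`-space over a field is a natural number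
`≤ n` (`0 ≤ dim K[X₁,…,Xₙ]/I ≤ dim K[X₁,…,Xₙ] = n` for `I ≠ ⊤`). [folklore] -/
theorem exists_nat_zariskiDim_eq {S : Set (Fin n → K)} (hS : S.Nonempty) :
    ∃ d : ℕ, d ≤ n ∧ zariskiDim K S = d := by
  obtain ⟨x, hx⟩ := hS
  have htop : vanishingIdeal K S ≠ ⊤ := by
    intro h
    have h1 : (1 : MvPolynomial (Fin n) K) ∈ vanishingIdeal K S := h ▸ Submodule.mem_top
    have := (mem_vanishingIdeal_iff.mp h1) x hx
    simp at this
  haveI : Nontrivial (MvPolynomial (Fin n) K ⧸ vanishingIdeal K S) :=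
    Ideal.Quotient.nontrivial_iff.mpr htop
  have hle : zariskiDim K S ≤ n := by
    unfold zariskiDim
    calc ringKrullDim (MvPolynomial (Fin n) K ⧸ vanishingIdeal K S)
        ≤ ringKrullDim (MvPolynomial (Fin n) K) :=
          ringKrullDim_le_of_surjective _ Ideal.Quotient.mk_surjective
      _ = n := by
          rw [MvPolynomial.ringKrullDim_of_isNoetherianRing, ringKrullDim_eq_zero_of_field]
          simp
  have hge : (0 : WithBot ℕ∞) ≤ zariskiDim K S := ringKrullDim_nonneg_of_nontrivial
  -- extract a natural number from `0 ≤ x ≤ n` in `WithBot ℕ∞`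
  generalize hx' : zariskiDim K S = x at hle hge
  induction x using WithBot.recBotCoe with
  | bot => exact absurd hge (by simp)
  | coe y =>
    induction y using ENat.recTopCoe with
    | top =>
      exfalso
      have : ((n : ℕ∞) : WithBot ℕ∞) < ((⊤ : ℕ∞) : WithBot ℕ∞) := WithBot.coe_lt_coe.mpr (ENat.coe_lt_top n)
      exact not_le.mpr this hle
    | coe d =>
      refine ⟨d, ?_, rfl⟩
      have : ((d : ℕ∞) : WithBot ℕ∞) ≤ ((n : ℕ∞) : WithBot ℕ∞) := hle
      exact_mod_cast this

/-! ### The case ladder -/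

/-- **EAC cell `(n, d)`.** Exponential-algebraic closedness of `ℂ_exp` restricted to the varieties
whose additive projection has `d`-dimensional Zariski closure: every irreducible rotund, additively
and multiplicatively free subvariety `V = W ∩ Gⁿ` of `Gⁿ = ℂⁿ × (ℂˣ)ⁿ` of dimension `n` with
`dim cl(π(V)) = d` meets the graph of `exp`. Same binders as
`Literature.NumberTheory.Transcendental.IsExpAlgClosed` plus `addProjDim ℂ n W = d`; the cells exhaust
EAC (`isExpAlgClosed_complex_iff_forall_ecCell`). An OPEN statement in general (never asserted);
known cells: `d = n` (Brownawell–Masser 2017 Prop. 2, tree theorem), `d = 1` (Mantova–Masser 2024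
Thm. 1.1), all `n ≤ 2` (Aslanyan–Gallinaro 2024 §3.4); `d = 0` is vacuous for `n ≥ 1`
(contradicts additive freeness). [cite: MantovaMasser2023, §1 Further remarks] -/
def ECCell (n d : ℕ) : Prop :=
  ∀ (W : Set (Fin n ⊕ Fin n → ℂ)), IsIrreducibleClosed ℂ W → (W ∩ torusLocus ℂ n).Nonempty →
    IsRotund ℂ n (W ∩ torusLocus ℂ n) → IsAddFree ℂ n (W ∩ torusLocus ℂ n) →
    IsMulFree ℂ n (W ∩ torusLocus ℂ n) → zariskiDim ℂ W = n → addProjDim ℂ n W = d →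
    (W ∩ expGraph ℂ n).Nonempty

/-- **EAC cell `(n, d)`, non-split part**: `ECCell n d` restricted to `W` NOT of Gallinaro's split
form `L × Z` (`IsLinearSplit`); together with Gallinaro 2023 Thm. 8.8 it gives the whole cell
(`ecCell_of_nonsplit`). OPEN for `n ≥ 3`, `2 ≤ d ≤ n - 1`. [cite: Gallinaro2022, Thm. 8.8] -/
def ECCellNonsplit (n d : ℕ) : Prop :=
  ∀ (W : Set (Fin n ⊕ Fin n → ℂ)), ¬ IsLinearSplit ℂ n W → IsIrreducibleClosed ℂ W →
    (W ∩ torusLocus ℂ n).Nonempty → IsRotund ℂ n (W ∩ torusLocus ℂ n) →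
    IsAddFree ℂ n (W ∩ torusLocus ℂ n) → IsMulFree ℂ n (W ∩ torusLocus ℂ n) →
    zariskiDim ℂ W = n → addProjDim ℂ n W = d → (W ∩ expGraph ℂ n).Nonempty

/-- **The ladder is exhaustive**: `ℂ_exp` is exponentially-algebraically closed iff every cell
`ECCell n d` holds (the closure of `π(V)` of a subvariety `V ≠ ∅` of `Gⁿ` has a dimension
`d ∈ {0, …, n}`, `exists_nat_zariskiDim_eq`). [folklore] -/
theorem isExpAlgClosed_complex_iff_forall_ecCell :
    IsExpAlgClosed ℂ ↔ ∀ n d : ℕ, ECCell n d := by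
  constructor
  · intro h n d W hW hne hrot hadd hmul hdim _
    exact h n W hW hne hrot hadd hmul hdim
  · intro h n W hW hne hrot hadd hmul hdim
    obtain ⟨d, -, hd⟩ := exists_nat_zariskiDim_eq (K := ℂ) (hne.image projAdd)
    exact h n d W hW hne hrot hadd hmul hdim hd

/-- A cell follows from its non-split part together with Gallinaro's theorem for split varieties
(stated below as `gallinaro2023_thm_8_8`), by cases on `IsLinearSplit`. [folklore] -/
theorem ecCell_of_nonsplit {n d : ℕ}
    (hG : ∀ (W : Set (Fin n ⊕ Fin n → ℂ)), IsLinearSplit ℂ n W → (W ∩ torusLocus ℂ n).Nonempty →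
      IsAddFree ℂ n (W ∩ torusLocus ℂ n) → IsRotund ℂ n (W ∩ torusLocus ℂ n) →
      (W ∩ expGraph ℂ n).Nonempty)
    (h : ECCellNonsplit n d) : ECCell n d := by
  intro W hW hne hrot hadd hmul hdim hd
  by_cases hs : IsLinearSplit ℂ n W
  · exact hG W hs hne hadd hrot
  · exact h W hs hW hne hrot hadd hmul hdim hd

/-! ### Proved cases (named facts; hypotheses as printed) -/

/-- **Marker 2006, Corollary 2.4** (J. Symb. Logic 71, p. 795; "reasonably well known"; proof by
Hadamard factorisation and the Henson–Rubel / van den Dries injectivity theorem): "If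
`p ∈ ℂ[X, Y]` is irreducible and depends on `X` and `Y` then `f(z) = p(z, e^z)` has infinitely many
zeros." Rendered on the curve `Z(p) ⊆ ℂ × ℂ`: infinitely many of its points lie on the graph of
`exp`; "depends on `X` and `Y`" = positive degree in each variable. This is the case `n = 1` of EAC
(Aslanyan–Gallinaro 2024, Thm. 3.7); it also follows from the tree theorem
`BrownawellMasser2017_dominantProjection_holds` (a free curve projects dominantly to `ℂ`).
[cite: Marker2006Remark, Cor. 2.4] -/
def marker2006_cor_2_4 : Prop :=
  ∀ p : MvPolynomial (Fin 1 ⊕ Fin 1) ℂ, Irreducible p →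
    0 < p.degreeOf (Sum.inl 0) → 0 < p.degreeOf (Sum.inr 0) →
    (zeroLocus ℂ (Ideal.span {p}) ∩ expGraph ℂ 1).Infinite

/-- **Aslanyan–Kirby–Mantova 2023, Theorem 1.5** (IMRN 2023, = arXiv:2105.12679 p. 4; attributed
there to Brownawell–Masser, JLMS 95 (2017) Prop. 2, and given a new proof in §5): "Let
`V ⊆ ℂⁿ × 𝔾ₘⁿ` be an algebraic subvariety with dominant projection to `ℂⁿ`. Then there is a point
`z̄ ∈ ℂⁿ` such that `(z̄, exp(z̄)) ∈ V`." No irreducibility or dimension hypothesis is printed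
(Mantova–Masser 2024 §1: for `dim V > n` "life just gets simpler"); the `dim V = n`, `V` irreducible
form is the tree THEOREM `Literature.NumberTheory.Transcendental.BrownawellMasser2017_dominantProjection_holds`,
from which this fact should be discharged (reduction to an irreducible component of dimension `≥ n`
with dominant projection, then generic hyperplane sections `X̂ᵢ = 1`).
[cite: AslanyanKirbyMantova2021, Thm. 1.5 (p. 4)] -/
def aslanyanKirbyMantova2023_thm_1_5 : Prop :=
  ∀ (n : ℕ) (W : Set (Fin n ⊕ Fin n → ℂ)), IsZariskiClosed ℂ W →
    HasDominantAddProjection ℂ (W ∩ torusLocus ℂ n) → (W ∩ expGraph ℂ n).Nonempty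

/-- **Mantova–Masser 2024, Theorem 1.1** (PLMS 129 (2024) e12627 = arXiv:2303.05592, §1): "Suppose
`V` is an irreducible algebraic variety in `ℂⁿ × ℂ*ⁿ`, of dimension at least `n`, such that the
Zariski closure of `π(V)` in `ℂⁿ` has dimension 1. If (AF) [`m₁X₁ + ⋯ + mₙXₙ = c`] does not hold
on `V` with any complex `c` and any integers `m₁, …, mₙ` not all zero, then `V` contains a point
(SZ) [`(z₁, …, zₙ, e^{z₁}, …, e^{zₙ})`]." The absence of (AF) is exactly `IsAddFree`; no rotundity
or multiplicative freeness is assumed. Proof: punctured Borel–Carathéodory, differentials on the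
curve `π(V)` (algebraic = analytic de Rham), Ax's theorem. [cite: MantovaMasser2023, Thm. 1.1] -/
def mantovaMasser2024_thm_1_1 : Prop :=
  ∀ (n : ℕ) (W : Set (Fin n ⊕ Fin n → ℂ)), IsIrreducibleClosed ℂ W →
    (W ∩ torusLocus ℂ n).Nonempty → (n : WithBot ℕ∞) ≤ zariskiDim ℂ W →
    addProjDim ℂ n W = 1 → IsAddFree ℂ n (W ∩ torusLocus ℂ n) → (W ∩ expGraph ℂ n).Nonempty

/-- **Gallinaro 2023, Theorem 8.8** (Selecta Math. 29 (2023) = arXiv:2203.13767, p. 23; the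
paper's main theorem, §1): "Let `L × W` be an additively free rotund variety, `L` a linear space. Then
`exp(L) ∩ W ≠ ∅`." Here `L ≤ ℂⁿ` is a linear subspace, `W ⊆ (ℂˣ)ⁿ` an irreducible algebraic
subvariety (standing assumption, §3 p. 6: "we will always assume our algebraic varieties to be
irreducible"), presented by its Zariski closure `Z` in `ℂⁿ` (`W = Z ∩ (ℂˣ)ⁿ`); additive freeness
and rotundity (Gallinaro Def. 3.1, via quotients by `ℚ`-linear subspaces) are the tree's
`IsAddFree` / `IsRotund` (Zilber 2005 §3, Kirby 2013 Def. 2.6, via integer matrices — the same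
notion) on `L × W = splitProd ↑L Z ∩ torusLocus`; `exp(L) ∩ W ≠ ∅` iff `L × W` meets the graph of
`exp`. Multiplicative freeness is not assumed. Earlier conditional/real cases: Zilber JLMS 65 (2002)
Thm. 5, Zilber 2011 Thm. 7.2. [cite: Gallinaro2022, Thm. 8.8] -/
def gallinaro2023_thm_8_8 : Prop :=
  ∀ (n : ℕ) (L : Submodule ℂ (Fin n → ℂ)) (Z : Set (Fin n → ℂ)), IsIrreducibleClosed ℂ Z →
    (splitProd (L : Set (Fin n → ℂ)) Z ∩ torusLocus ℂ n).Nonempty →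
    IsAddFree ℂ n (splitProd (L : Set (Fin n → ℂ)) Z ∩ torusLocus ℂ n) →
    IsRotund ℂ n (splitProd (L : Set (Fin n → ℂ)) Z ∩ torusLocus ℂ n) →
    (splitProd (L : Set (Fin n → ℂ)) Z ∩ expGraph ℂ n).Nonempty

/-- Gallinaro's theorem in the `IsLinearSplit` presentation used by `ecCell_of_nonsplit`.
[cite: Gallinaro2022, Thm. 8.8] -/
theorem gallinaro2023_thm_8_8.of_isLinearSplit (hG : gallinaro2023_thm_8_8) {n : ℕ}
    (W : Set (Fin n ⊕ Fin n → ℂ)) (hs : IsLinearSplit ℂ n W) (hne : (W ∩ torusLocus ℂ n).Nonempty)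
    (hadd : IsAddFree ℂ n (W ∩ torusLocus ℂ n)) (hrot : IsRotund ℂ n (W ∩ torusLocus ℂ n)) :
    (W ∩ expGraph ℂ n).Nonempty := by
  obtain ⟨L, Z, hZ, rfl⟩ := hs
  exact hG n L Z hZ hne hadd hrot

/-- Hence every cell reduces to its non-split part, granted Gallinaro 2023 Thm. 8.8.
[cite: Gallinaro2022, Thm. 8.8] -/
theorem ecCell_of_gallinaro_of_nonsplit (hG : gallinaro2023_thm_8_8) {n d : ℕ}
    (h : ECCellNonsplit n d) : ECCell n d :=
  ecCell_of_nonsplit (fun W hs hne hadd hrot => hG.of_isLinearSplit W hs hne hadd hrot) h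

/-- **Aslanyan–Gallinaro 2024, §3.4** (arXiv:2409.12860 p. 14, after Thm. 3.8 = Brownawell–Masser
2017 Prop. 2 and Thm. 3.9 = Mantova–Masser 2024 Thm. 1.1): "Together, these results imply [Exponential
Closedness, their 3.4] for all subvarieties of `ℂ² × (ℂˣ)²`." Recorded as the cells with
`n ≤ 2`; it should be discharged in the tree from `BrownawellMasser2017_dominantProjection_holds`,
`mantovaMasser2024_thm_1_1` and the case split `addProjDim ∈ {0, 1, 2}` (see also Mantova–Masser
2024 Thm. 1.2, the complete description of `π(Z)` for surfaces).
[cite: AslanyanGallinaro2024, §3.4 (p. 14)] -/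
def aslanyanGallinaro2024_ec_le_two : Prop :=
  ∀ n d : ℕ, n ≤ 2 → ECCell n d

/-! ### Assembly of the ladder -/

/-- The whole ladder: the known cells (`d = 0` vacuous, `d = 1` Mantova–Masser, `d = n`
Brownawell–Masser, `n ≤ 2` Aslanyan–Gallinaro) and the open regime `n ≥ 3`, `2 ≤ d ≤ n - 1`
(Mantova–Masser 2024 §1 "π(V) of other dimensions"; the hypothesis `hopen`, an OPEN statement)
together give EAC — bookkeeping only
(`d = 0` is impossible for an additively free `V` when `n ≥ 1`, recorded as the hypothesis `h0`;
the cells with `n ≤ 2`, including the trivial `n = 0`, are `h2`). [folklore] -/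
theorem isExpAlgClosed_complex_of_ladder
    (h0 : ∀ n, 1 ≤ n → ECCell n 0) (h1 : ∀ n, ECCell n 1)
    (hdiag : ∀ n, ECCell n n) (h2 : aslanyanGallinaro2024_ec_le_two)
    (hopen : ∀ n d : ℕ, 3 ≤ n → 2 ≤ d → d + 1 ≤ n → ECCell n d) :
    IsExpAlgClosed ℂ := by
  rw [isExpAlgClosed_complex_iff_forall_ecCell]
  intro n d W hW hne hrot hadd hmul hdim hd
  -- `d ≤ n`
  obtain ⟨d', hd'n, hd'⟩ := exists_nat_zariskiDim_eq (K := ℂ) (hne.image projAdd)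
  have hdd : d = d' := by
    have : (d : WithBot ℕ∞) = d' := by rw [← hd', ← hd]; rfl
    exact_mod_cast this
  subst hdd
  rcases Nat.lt_or_ge n 3 with hn | hn
  · exact h2 n d (by omega) W hW hne hrot hadd hmul hdim hd
  rcases Nat.lt_or_ge d 2 with hd2 | hd2
  · interval_cases d
    · exact h0 n (by omega) W hW hne hrot hadd hmul hdim hd
    · exact h1 n W hW hne hrot hadd hmul hdim hd
  rcases Nat.lt_or_ge d n with hdn | hdn
  · exact hopen n d hn hd2 (by omega) W hW hne hrot hadd hmul hdim hd
  · have : d = n := le_antisymm hd'n hdn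
    subst this
    exact hdiag d W hW hne hrot hadd hmul hdim hd

end Literature.ModelTheory.Zilber
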